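import Summits.Ventures.DiscreteObjects.Hadamard.ElemAbelianAction

/-!
# Hadamard 668 census, family F12 — `C₂₃ × C₂₃`: Burnside counting on the 24 lines of `(ℤ/23)²` (kernel)

Framing: lottery ticket; floor = certified bounds/negative ranges.

Cell pub-namedobj (venture DiscreteObjects), target (H), hadamard gen 16.  Pure counting step of `ElemAbelianRank2_23`.
Let `f : (ℤ/23)² → ℕ` (`(ℤ/23)²` as `Multiplicative (ZMod 23 × ZMod 23)`) (the number of fixed rows of the signed automorphism attached to `g`) satisfy: `f 1 = 668`;
`f g ∈ {1, 24}` for `g ≠ 1` (fixed-structure census for order 23); `f` is constant on punctured lines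
(`f (g^(k+1)) = f g`, `k < 22`: a power `σ^m`, `0 < m < 23`, has the fixed points of `σ`); and `23² ∣ Σ_g f g`
(Burnside).  Writing `A = #{g ≠ 1 : f g = 24}`: `Σ_g f g = 1196 + 23 A`, so `A ≡ 17 (mod 23)`; the special elements form
whole punctured lines (22 elements each, pairwise disjoint), hence `A ∈ {22 s}` … concretely: `A ≥ 17 ⇒` a special
`g₀`; its line gives `A ≥ 22 ⇒ A ≥ 40 ⇒` a special `h₁` off the line of `g₀`; the two lines give `A ≥ 44 ⇒ A ≥ 63 ⇒` a
special `h₂` off both lines; and `A ≠ 528` gives a non-special `t ≠ 1` (`f t = 1`).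
**`exists_three_special_23`**.  (In the application exactly six of the 24 lines are special.)  Ours; no `sorry`.
-/

namespace Summit.Ventures.DiscreteObjects.Hadamard

open Finset BigOperators

/-- in `(ℤ/23)²`: `g^m = 1` with `0 < m < 23` forces `g = 1` -/
lemma eq_one_of_pow_eq_one_23 {g : Multiplicative (ZMod 23 × ZMod 23)} {m : ℕ} (hm0 : 0 < m) (hm : m < 23)
    (h : g ^ m = 1) : g = 1 := by
  haveI : Fact (Nat.Prime 23) := ⟨by norm_num⟩
  have hcop : Nat.Coprime m 23 :=
    Nat.Coprime.symm ((Nat.Prime.coprime_iff_not_dvd (by norm_num)).2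
      (fun h => absurd (Nat.le_of_dvd hm0 h) (not_le.2 hm)))
  obtain ⟨u, -, hu⟩ := Nat.exists_mul_mod_eq_one_of_coprime hcop (by norm_num)
  have h23 : g ^ 23 = 1 := pair_pow_p 23 g
  calc g = g ^ ((m * u) % 23) := by rw [hu, pow_one]
    _ = g ^ (m * u) := (pow_eq_pow_mod _ h23).symm
    _ = 1 := by rw [pow_mul, h, one_pow]

/-- membership in a punctured line -/
lemma mem_line_iff (g h : Multiplicative (ZMod 23 × ZMod 23)) :
    h ∈ (Finset.range 22).image (fun k => g ^ (k + 1)) ↔ ∃ k, k < 22 ∧ h = g ^ (k + 1) := by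
  simp only [Finset.mem_image, Finset.mem_range]
  constructor
  · rintro ⟨k, hk, rfl⟩; exact ⟨k, hk, rfl⟩
  · rintro ⟨k, hk, rfl⟩; exact ⟨k, hk, rfl⟩

/-- a punctured line of `g ≠ 1` has 22 elements -/
lemma card_line {g : Multiplicative (ZMod 23 × ZMod 23)} (hg : g ≠ 1) : ((Finset.range 22).image (fun k => g ^ (k + 1))).card = 22 := by
  rw [Finset.card_image_of_injOn, Finset.card_range]
  intro k hk l hl hkl
  simp only [Finset.coe_range, Set.mem_Iio] at hk hl
  simp only at hkl
  by_contra hne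
  rcases Nat.lt_or_gt_of_ne hne with hlt | hlt
  · have : g ^ (l - k) = 1 := by
      have e : g ^ (l + 1) = g ^ (k + 1) * g ^ (l - k) := by rw [← pow_add]; congr 1; omega
      rw [← hkl] at e
      exact (mul_eq_left.mp e.symm)
    exact hg (eq_one_of_pow_eq_one_23 (by omega) (by omega) this)
  · have : g ^ (k - l) = 1 := by
      have e : g ^ (k + 1) = g ^ (l + 1) * g ^ (k - l) := by rw [← pow_add]; congr 1; omega
      rw [hkl] at e
      exact (mul_eq_left.mp e.symm)
    exact hg (eq_one_of_pow_eq_one_23 (by omega) (by omega) this)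

/-- `1` is not on a punctured line of `g ≠ 1` -/
lemma one_not_mem_line {g : Multiplicative (ZMod 23 × ZMod 23)} (hg : g ≠ 1) :
    (1 : Multiplicative (ZMod 23 × ZMod 23)) ∉ (Finset.range 22).image (fun k => g ^ (k + 1)) := by
  rw [mem_line_iff]
  rintro ⟨k, hk, h⟩
  exact hg (eq_one_of_pow_eq_one_23 (by omega) (by omega : k + 1 < 23) h.symm)

/-- two punctured lines are disjoint unless the second generator lies on the first line -/
lemma disjoint_lines {g h : Multiplicative (ZMod 23 × ZMod 23)} (hh : h ≠ 1)
    (hgh : h ∉ (Finset.range 22).image (fun k => g ^ (k + 1))) :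
    Disjoint ((Finset.range 22).image (fun k => g ^ (k + 1))) ((Finset.range 22).image (fun k => h ^ (k + 1))) := by
  haveI : Fact (Nat.Prime 23) := ⟨by norm_num⟩
  rw [Finset.disjoint_left]
  intro x hxg hxh
  rw [mem_line_iff] at hxg hxh
  obtain ⟨k, hk, rfl⟩ := hxg
  obtain ⟨l, hl, hkl⟩ := hxh
  -- h^(l+1) = g^(k+1); invert l+1 mod 23
  have hcop : Nat.Coprime (l + 1) 23 :=
    Nat.Coprime.symm ((Nat.Prime.coprime_iff_not_dvd (by norm_num)).2
      (fun hd => absurd (Nat.le_of_dvd (by omega) hd) (by omega)))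
  obtain ⟨u, -, hu⟩ := Nat.exists_mul_mod_eq_one_of_coprime hcop (by norm_num)
  have h23 : h ^ 23 = 1 := pair_pow_p 23 h
  have g23 : g ^ 23 = 1 := pair_pow_p 23 g
  have hh' : h = g ^ (((k + 1) * u) % 23) := by
    calc h = h ^ (((l + 1) * u) % 23) := by rw [hu, pow_one]
      _ = h ^ ((l + 1) * u) := (pow_eq_pow_mod _ h23).symm
      _ = (h ^ (l + 1)) ^ u := by rw [pow_mul]
      _ = (g ^ (k + 1)) ^ u := by rw [hkl]
      _ = g ^ ((k + 1) * u) := by rw [← pow_mul]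
      _ = g ^ (((k + 1) * u) % 23) := pow_eq_pow_mod _ g23
  set m := ((k + 1) * u) % 23 with hm
  have hmlt : m < 23 := Nat.mod_lt _ (by norm_num)
  rcases Nat.eq_zero_or_pos m with hm0 | hm0
  · rw [hm0, pow_zero] at hh'; exact hh hh'
  · apply hgh
    rw [mem_line_iff]
    exact ⟨m - 1, by omega, by rw [hh']; congr 1; omega⟩

/-- **three special elements on three different lines, and one non-special element.** -/
theorem exists_three_special_23 (f : Multiplicative (ZMod 23 × ZMod 23) → ℕ) (hf1 : f 1 = 668)
    (hf : ∀ g, g ≠ 1 → f g = 1 ∨ f g = 24) (hdvd : 23 ^ 2 ∣ ∑ g, f g)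
    (hpow : ∀ g, g ≠ 1 → ∀ k, k < 22 → f (g ^ (k + 1)) = f g) :
    ∃ g₀ h₁ h₂ t : Multiplicative (ZMod 23 × ZMod 23), g₀ ≠ 1 ∧ h₁ ≠ 1 ∧ h₂ ≠ 1 ∧ t ≠ 1 ∧
      f g₀ = 24 ∧ f h₁ = 24 ∧ f h₂ = 24 ∧ f t = 1 ∧
      h₁ ∉ (Finset.range 22).image (fun k => g₀ ^ (k + 1)) ∧ h₂ ∉ (Finset.range 22).image (fun k => g₀ ^ (k + 1)) ∧
      h₂ ∉ (Finset.range 22).image (fun k => h₁ ^ (k + 1)) := by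
  classical
  haveI : Fact (Nat.Prime 23) := ⟨by norm_num⟩
  -- special and non-special elements
  set S := (univ : Finset (Multiplicative (ZMod 23 × ZMod 23))).filter (fun g => g ≠ 1 ∧ f g = 24) with hS
  set T := (univ : Finset (Multiplicative (ZMod 23 × ZMod 23))).filter (fun g => g ≠ 1 ∧ f g = 1) with hT
  have hcardG : (univ : Finset (Multiplicative (ZMod 23 × ZMod 23))).card = 529 := by
    rw [Finset.card_univ, Fintype.card_multiplicative, Fintype.card_prod, ZMod.card]
  -- partition of univ
  have hST : Disjoint S T := by
    rw [Finset.disjoint_left]; intro g h1 h2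
    rw [hS, Finset.mem_filter] at h1; rw [hT, Finset.mem_filter] at h2; omega
  have hunion : S ∪ T = (univ : Finset (Multiplicative (ZMod 23 × ZMod 23))).erase 1 := by
    ext g
    rw [Finset.mem_union, hS, hT, Finset.mem_filter, Finset.mem_filter, Finset.mem_erase]
    constructor
    · rintro (⟨-, h, -⟩ | ⟨-, h, -⟩) <;> exact ⟨h, Finset.mem_univ _⟩
    · rintro ⟨h, -⟩
      rcases hf g h with h' | h'
      · exact Or.inr ⟨Finset.mem_univ _, h, h'⟩
      · exact Or.inl ⟨Finset.mem_univ _, h, h'⟩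
  have hcards : S.card + T.card = 528 := by
    rw [← Finset.card_union_of_disjoint hST, hunion, Finset.card_erase_of_mem (Finset.mem_univ _), hcardG]
  -- the sum
  have hsum : ∑ g, f g = 668 + 24 * S.card + T.card := by
    rw [← Finset.sum_erase_add _ _ (Finset.mem_univ (1 : Multiplicative (ZMod 23 × ZMod 23))), hf1, ← hunion,
      Finset.sum_union hST]
    have h1 : ∑ g ∈ S, f g = 24 * S.card := by
      rw [Finset.sum_congr rfl (fun g hg => ((Finset.mem_filter.mp hg).2.2 : f g = 24)), Finset.sum_const,
        smul_eq_mul, mul_comm]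
    have h2 : ∑ g ∈ T, f g = T.card := by
      rw [Finset.sum_congr rfl (fun g hg => ((Finset.mem_filter.mp hg).2.2 : f g = 1)), Finset.sum_const,
        smul_eq_mul, mul_one]
    rw [h1, h2]; ring
  rw [hsum] at hdvd
  obtain ⟨c, hc⟩ := hdvd
  have hA : S.card % 23 = 17 := by omega
  -- lines of special elements are special
  have line_sub : ∀ g, g ∈ S → (Finset.range 22).image (fun k => g ^ (k + 1)) ⊆ S := by
    intro g hg x hx
    rw [hS, Finset.mem_filter] at hg ⊢
    rw [mem_line_iff] at hx
    obtain ⟨k, hk, rfl⟩ := hx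
    refine ⟨Finset.mem_univ _, fun h => hg.2.1 (eq_one_of_pow_eq_one_23 (by omega) (by omega : k + 1 < 23) h), ?_⟩
    rw [hpow g hg.2.1 k hk]; exact hg.2.2
  -- a special g₀
  have hSpos : 0 < S.card := by omega
  obtain ⟨g₀, hg₀⟩ := Finset.card_pos.mp hSpos
  have hg₀' := hg₀; rw [hS, Finset.mem_filter] at hg₀'
  have hL0 := Finset.card_le_card (line_sub g₀ hg₀)
  rw [card_line hg₀'.2.1] at hL0
  -- A ≥ 22 ⇒ A ≥ 40 ⇒ an element of S off the line of g₀
  have h40 : 40 ≤ S.card := by omega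
  have hex1 : ∃ h₁ ∈ S, h₁ ∉ (Finset.range 22).image (fun k => g₀ ^ (k + 1)) := by
    by_contra hno
    have := Finset.card_le_card
      (show S ⊆ (Finset.range 22).image (fun k => g₀ ^ (k + 1)) from
        fun x hx => by_contra fun hx' => hno ⟨x, hx, hx'⟩)
    rw [card_line hg₀'.2.1] at this; omega
  obtain ⟨h₁, hh₁, hh₁L⟩ := hex1
  have hh₁' := hh₁; rw [hS, Finset.mem_filter] at hh₁'
  have hdis := disjoint_lines hh₁'.2.1 hh₁L
  have hL01 := Finset.card_le_card (Finset.union_subset (line_sub g₀ hg₀) (line_sub h₁ hh₁))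
  rw [Finset.card_union_of_disjoint hdis, card_line hg₀'.2.1, card_line hh₁'.2.1] at hL01
  have h63 : 63 ≤ S.card := by omega
  have hex2 : ∃ h₂ ∈ S,
      h₂ ∉ (Finset.range 22).image (fun k => g₀ ^ (k + 1)) ∪ (Finset.range 22).image (fun k => h₁ ^ (k + 1)) := by
    by_contra hno
    have := Finset.card_le_card (show S ⊆ (Finset.range 22).image (fun k => g₀ ^ (k + 1)) ∪
      (Finset.range 22).image (fun k => h₁ ^ (k + 1)) from fun x hx => by_contra fun hx' => hno ⟨x, hx, hx'⟩)
    rw [Finset.card_union_of_disjoint hdis, card_line hg₀'.2.1, card_line hh₁'.2.1] at this; omega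
  obtain ⟨h₂, hh₂, hh₂L⟩ := hex2
  have hh₂' := hh₂; rw [hS, Finset.mem_filter] at hh₂'
  rw [Finset.mem_union, not_or] at hh₂L
  -- a non-special t
  have hTpos : 0 < T.card := by omega
  obtain ⟨t, ht⟩ := Finset.card_pos.mp hTpos
  rw [hT, Finset.mem_filter] at ht
  exact ⟨g₀, h₁, h₂, t, hg₀'.2.1, hh₁'.2.1, hh₂'.2.1, ht.2.1, hg₀'.2.2, hh₁'.2.2, hh₂'.2.2, ht.2.2,
    hh₁L, hh₂L.1, hh₂L.2⟩

end Summit.Ventures.DiscreteObjects.Hadamard
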